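import Literature.Geometry.Symplectic.OrigamiNullFoliation
import Literature.Geometry.Kaehler.ManifoldFormsChart
import Literature.Topology.FourManifolds.RegularLevelCollar
import Mathlib.Analysis.SpecialFunctions.SmoothTransition
import Mathlib.Analysis.InnerProductSpace.Calculus
import HarnessLib

/-!
# A vector field adapted to the kernel of a folded symplectic form along its fold;
# the kernel-adapted collar data

Proofs companion of `OrigamiUnfolding.lean` (the named fact
`Literature.Geometry.Symplectic.exists_symplecticCutPieces_of_isOrigamiForm`, Cannas da
Silva–Guillemin–Pires, *Symplectic Origami*, IMRN 2011 = arXiv:0909.4065, Prop. 2.8; architecture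
in `OrigamiUnfoldingProofs.lean`, steps (S0)–(S4)), continuing `OrigamiFoldDefiningFunction.lean`
(the fold `Z` of a folded form on an oriented 4-manifold is the regular zero level of a smooth
function `f` with the sides as signs).  Step (S1) of the unfolding normalises `ω` on a collar
`φ : Z × (-ε, ε) → 𝒰` of the fold to `p*i*ω + d(t² p*α)` (Cannas da Silva–Guillemin–Woodward
2000, Thm. 1); every route to it (folded Moser isotopy, or matching of jets followed by
interpolation) starts from a collar whose normal direction `∂/∂t` along `Z` lies in the
`2`-plane `E = ker ω` of Def. 2.1 — then `φ*ω` restricted to `Z × {0}` is exactly `p*i*ω`, with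
no `dt`-component.  Such a collar is the flow-out of the fold along a vector field `ξ` with
`ξ(f) = 1` near `Z` (Milnor's product neighbourhood of a regular level,
`Topology/FourManifolds/RegularLevelCollar.lean`) which along `Z` lies in `ker ω`.  This file
constructs the field:

* `contDiff_pfaffAdjCol` — the Pfaffian-adjugate columns `c_k(α)` (`OrigamiNullFoliation.lean`:
  `α(c_k(α), ·) = -Pf(α) (·)_k`, two of them independent when `α ≠ 0`) are smooth in `α`;
* local sections: `contMDiffOn_symmL_pfaffAdjCol` — `x ↦ e.symmL x (c_k (s.inChart x₀ (φ x)))`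
  (`e` the trivialisation of `TM` at `x₀`, Mathlib's `TangentBundle.symmL_trivializationAt`:
  `e.symmL x = d(φ⁻¹)`) is a `C^∞` local section of `TM`; `symmL_pfaffAdjCol_mem_ker` — at fold
  points of the chart domain it lies in `ker ω_x` (the chart representative is the pull-back
  of `ω_x` by the invertible `d(φ⁻¹)`, and the chart Pfaffian vanishes);
  `symmL_trivializationAt_self`; `IsFoldedForm.exists_mfderiv_pfaffAdjCol_ne_zero` — at a fold
  point some column of `ω_{x₀}` is transverse to the fold, i.e. not killed by `df` (the columns
  span `E`, and `E ⊄ TZ = ker df` is the maximal-rank clause of Def. 2.1);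
  `IsFoldedForm.exists_local_kernelSection` — dividing by `W(f)`: a smooth local field `V`
  with `V(f) = 1` and `V_x ∈ ker ω_x` at the fold points near `x₀`;
* **`IsFoldedForm.exists_kernelAdaptedField`** — a GLOBAL smooth vector field `V` with
  `V_x ∈ ker ω_x` and `V(f)(x) = 1` at every fold point (Mathlib's
  `exists_contMDiffSection_forall_mem_convex_of_local` for the convex constraint sets
  `convex_kernelConstraint`, fed with the local kernel sections and the zero field off the
  closed fold);
* **`IsFoldedForm.exists_kernelAdapted_levelUnitField`** — on a compact `M`: a unit field
  `U : LevelUnitField 3 f 0` (`U.ξ(f) = 1` on a band `f⁻¹[-δ, δ]`, obtained as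
  `(χ(4V(f)-1)/V(f)) • V` with Mathlib's `Real.smoothTransition` as cut-off `χ`,
  `contDiff_smoothTransition_mul_inv`; the band exists by compactness, `exists_band_subset`)
  whose vectors along the fold lie in `ker ω`;
* the package for a folded / origami form on a compact oriented 4-manifold — the defining
  function `f` of `OrigamiFoldDefiningFunction.lean` (`IsRegularLevel (𝓡 4) f 0`, `f⁻¹(0) = Z`,
  `{±f > 0} = M^±`, `ker df = TZ`) fed into `exists_kernelAdapted_levelUnitField`, and the
  resulting kernel-adapted product collar `Z × (-δ, δ) ≅ f⁻¹(-δ, δ)` (`OrigamiFoldCollar.lean`)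
  — is assembled in the sequel `OrigamiFoldCollarData.lean`.

Everything here is proved; no definitions, no named facts (D-0026).

## References

* [CannasdasilvaGuilleminPires2010] A. Cannas da Silva, V. Guillemin, A. R. Pires, *Symplectic
  Origami*, IMRN 2011, 4252–4293 = arXiv:0909.4065, Def. 2.1 (`E = ker ω`, maximal rank),
  Prop. 2.8 (unfolding; the Moser model of its proof).
* A. Cannas da Silva, V. Guillemin, C. Woodward, *On the unfolding of folded symplectic
  structures*, Math. Res. Lett. 7 (2000) 35–53, Thm. 1.
* J. Milnor, *Lectures on the h-cobordism theorem* (1965), Lemma 3.2, Thm. 3.4 (unit fields and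
  product neighbourhoods by partitions of unity and flows). [MilnorHCobordism1965]
-/

noncomputable section

open scoped Manifold ContDiff Topology
open Set Function Filter Bundle
open Literature.Geometry.Kaehler Literature.Topology.FourManifolds

namespace Literature.Geometry.Symplectic

/-! ### Smoothness of the Pfaffian adjugate -/

section Adjugate

/-- The columns of the Pfaffian adjugate depend smoothly (linearly) on the form. [folklore] -/
theorem contDiff_pfaffAdjCol (k : Fin 4) :
    ContDiff ℝ ∞ fun α : (EuclideanSpace ℝ (Fin 4)) [⋀^Fin 2]→L[ℝ] ℝ => pfaffAdjCol α k := by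
  rw [contDiff_euclidean]
  intro i
  fin_cases k <;> fin_cases i <;>
  · simp only [pfaffAdjCol]
    simp
    first
      | exact contDiff_const
      | exact contDiff_alt_two_eval _
      | exact (contDiff_alt_two_eval _).neg

end Adjugate

variable {M : Type*} [TopologicalSpace M] [ChartedSpace (EuclideanSpace ℝ (Fin 4)) M]
  [IsManifold (𝓡 4) ∞ M]
variable {N : Type} [TopologicalSpace N] [ChartedSpace (EuclideanSpace ℝ (Fin 3)) N] {j : N → M}

/-! ### Local kernel sections near a fold point -/

section Local

omit [IsManifold (𝓡 4) ∞ M] in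
/-- Homogeneity of `ω_x` in the first slot, for tangent vectors (the scalar action of the
tangent space). [folklore] -/
theorem mform_smul_left (s : MForm (𝓡 4) M ℝ 2) (x : M) (c : ℝ) (v w : TangentSpace (𝓡 4) x) :
    s x ![c • v, w] = c * s x ![v, w] :=
  alt_two_smul_left (s x) c v w

omit [IsManifold (𝓡 4) ∞ M] in
/-- Additivity of `ω_x` in the first slot, for tangent vectors. [folklore] -/
theorem mform_add_left (s : MForm (𝓡 4) M ℝ 2) (x : M) (v v' w : TangentSpace (𝓡 4) x) :
    s x ![v + v', w] = s x ![v, w] + s x ![v', w] :=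
  alt_two_add_left (s x) v v' w

/-- **The transported adjugate column is a smooth local section.** For the trivialisation `e`
of `TM` at `x₀` and a smooth form `s`, the section
`x ↦ e.symmL x (c_k (s.inChart x₀ (φ_{x₀} x)))` is `C^∞` on the chart domain. [folklore] -/
theorem contMDiffOn_symmL_pfaffAdjCol {s : MForm (𝓡 4) M ℝ 2} (hs : IsSmoothForm s) (x₀ : M)
    (k : Fin 4) :
    ContMDiffOn (𝓡 4) (𝓡 4).tangent ∞
      (fun x => (⟨x, (trivializationAt (EuclideanSpace ℝ (Fin 4)) (TangentSpace (𝓡 4)) x₀).symmL ℝ x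
        (pfaffAdjCol (s.inChart x₀ (extChartAt (𝓡 4) x₀ x)) k)⟩ : TangentBundle (𝓡 4) M))
      (extChartAt (𝓡 4) x₀).source := by
  set e := trivializationAt (EuclideanSpace ℝ (Fin 4)) (TangentSpace (𝓡 4) : M → Type _) x₀
    with he
  have hbase : e.baseSet = (extChartAt (𝓡 4) x₀).source := by
    rw [he, TangentBundle.trivializationAt_baseSet, extChartAt_source]
  rw [← hbase, e.contMDiffOn_section_baseSet_iff]
  -- in the trivialisation the section reads `x ↦ c_k (s.inChart x₀ (φ x))`
  have hc : ContMDiffOn (𝓡 4) 𝓘(ℝ, EuclideanSpace ℝ (Fin 4)) ∞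
      (fun x => pfaffAdjCol (s.inChart x₀ (extChartAt (𝓡 4) x₀ x)) k) e.baseSet := by
    rw [hbase]
    have h1 : ContMDiffOn 𝓘(ℝ, EuclideanSpace ℝ (Fin 4)) 𝓘(ℝ, EuclideanSpace ℝ (Fin 4)) ∞
        (fun y => pfaffAdjCol (s.inChart x₀ y) k) (extChartAt (𝓡 4) x₀).target :=
      ((contDiff_pfaffAdjCol k).comp_contDiffOn
        (Literature.Geometry.Kaehler.IsSmoothForm.contDiffOn_inChart hs x₀)).contMDiffOn
    have h2 : ContMDiffOn (𝓡 4) 𝓘(ℝ, EuclideanSpace ℝ (Fin 4)) ∞ (extChartAt (𝓡 4) x₀)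
        (extChartAt (𝓡 4) x₀).source := by
      rw [extChartAt_source]
      exact contMDiffOn_extChartAt
    exact h1.comp h2 fun y hy => (extChartAt (𝓡 4) x₀).map_source hy
  refine hc.congr fun x hx => ?_
  change (e ⟨x, e.symmL ℝ x _⟩).2 = _
  rw [e.symmL_apply hx, e.apply_mk_symm hx]

/-- **The transported adjugate columns lie in the kernel along the fold**: at a fold point `x`
of the chart domain at `x₀`, `ω_x (e.symmL x (c_k (s.inChart x₀ (φ_{x₀} x))), w) = 0` for every
`w` (the chart representative is the pull-back of `ω_x` by the invertible `e.symmL x = d(φ⁻¹)`,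
and `α(c_k(α), ·) = -Pf(α) (·)_k = 0` where the chart Pfaffian vanishes).
[cite: CannasdasilvaGuilleminPires2010, Def. 2.1] -/
theorem symmL_pfaffAdjCol_mem_ker (s : MForm (𝓡 4) M ℝ 2) (x₀ : M) (k : Fin 4) {x : M}
    (hx : x ∈ (extChartAt (𝓡 4) x₀).source) (hxf : x ∈ fold s)
    (w : TangentSpace (𝓡 4) x) :
    s x ![(trivializationAt (EuclideanSpace ℝ (Fin 4)) (TangentSpace (𝓡 4)) x₀).symmL ℝ x
        (pfaffAdjCol (s.inChart x₀ (extChartAt (𝓡 4) x₀ x)) k), w] = 0 := by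
  set φ := extChartAt (𝓡 4) x₀ with hφ
  have hx' : x ∈ (chartAt (EuclideanSpace ℝ (Fin 4)) x₀).source := by rwa [← extChartAt_source (𝓡 4)]
  have hy : φ x ∈ φ.target := φ.map_source hx
  set D := mfderivWithin 𝓘(ℝ, EuclideanSpace ℝ (Fin 4)) (𝓡 4) φ.symm (range (𝓡 4)) (φ x) with hD
  have hsymmL : (trivializationAt (EuclideanSpace ℝ (Fin 4)) (TangentSpace (𝓡 4)) x₀).symmL ℝ x = D :=
    TangentBundle.symmL_trivializationAt hx'
  rw [hsymmL]
  -- `D` is invertible: write `w = D w'`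
  have hDinv := isInvertible_mfderivWithin_extChartAt_symm (I := 𝓡 4) hy
  obtain ⟨w', rfl⟩ := hDinv.bijective.2 w
  -- the chart Pfaffian vanishes at `φ x`
  have hPf : pfaffian (s.inChart x₀ (φ x)) = 0 := (mem_fold_iff_pfaffian_inChart s x₀ hx).1 hxf
  have h1 := alt_two_pfaffAdjCol (s.inChart x₀ (φ x)) k w'
  rw [hPf, neg_zero, zero_mul, MForm.inChart_apply] at h1
  -- `s (φ.symm (φ x))` versus `s x`
  have h2 : (fun i => D (![pfaffAdjCol (s.inChart x₀ (φ x)) k, w'] i)) =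
      ![D (pfaffAdjCol (s.inChart x₀ (φ x)) k), D w'] := by
    funext i
    fin_cases i <;> rfl
  have key : ∀ {p q : M} (_ : p = q) (u : Fin 2 → EuclideanSpace ℝ (Fin 4)), s p u = s q u := by
    intro p q hpq u
    subst hpq
    rfl
  rw [h2, key (φ.left_inv hx)] at h1
  exact h1

/-- At the centre of the chart the inverse trivialisation of `TM` is the identity (on
coordinate vectors). [folklore] -/
theorem symmL_trivializationAt_self (x₀ : M) (v : EuclideanSpace ℝ (Fin 4)) :
    ((trivializationAt (EuclideanSpace ℝ (Fin 4)) (TangentSpace (𝓡 4)) x₀).symmL ℝ x₀ v :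
      EuclideanSpace ℝ (Fin 4)) = v := by
  have hx' : x₀ ∈ (chartAt (EuclideanSpace ℝ (Fin 4)) x₀).source := mem_chart_source _ x₀
  have h1 : (trivializationAt (EuclideanSpace ℝ (Fin 4)) (TangentSpace (𝓡 4)) x₀).symmL ℝ x₀ =
      mfderivWithin 𝓘(ℝ, EuclideanSpace ℝ (Fin 4)) (𝓡 4) (extChartAt (𝓡 4) x₀).symm (range (𝓡 4))
        (extChartAt (𝓡 4) x₀ x₀) := TangentBundle.symmL_trivializationAt hx'
  have h2 : mfderivWithin 𝓘(ℝ, EuclideanSpace ℝ (Fin 4)) (𝓡 4) (extChartAt (𝓡 4) x₀).symm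
      (range (𝓡 4)) (extChartAt (𝓡 4) x₀ x₀) = tangentCoordChange (𝓡 4) x₀ x₀ x₀ := by
    rw [mfderivWithin_extChartAt_symm_eq_tangentCoordChange (mem_extChartAt_target (I := 𝓡 4) x₀),
      extChartAt_to_inv (I := 𝓡 4) x₀]
  have h3 : tangentCoordChange (𝓡 4) x₀ x₀ x₀ v = v := tangentCoordChange_self (mem_extChartAt_source x₀)
  rw [h1, h2]
  exact h3

omit [IsManifold (𝓡 4) ∞ M] in
/-- **Some adjugate column of `ω_{x₀}` is transverse to the fold** at a fold point `x₀ = j n`: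
the columns span the `2`-plane `E = ker ω_{x₀}`, which is not contained in
`T_{x₀} Z = ker df_{x₀}` by the maximal-rank clause of Def. 2.1; here `f` is any function whose
differential at `x₀` has kernel exactly `T_{x₀} Z`. [cite: CannasdasilvaGuilleminPires2010, Def. 2.1] -/
theorem IsFoldedForm.exists_mfderiv_pfaffAdjCol_ne_zero {s : MForm (𝓡 4) M ℝ 2}
    (h : IsFoldedForm s N j) {f : M → ℝ} (n : N)
    (hker : ∀ v : TangentSpace (𝓡 4) (j n), mfderiv (𝓡 4) 𝓘(ℝ, ℝ) f (j n) v = 0 →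
      v ∈ Set.range (mfderiv (𝓡 3) (𝓡 4) j n)) :
    ∃ k : Fin 4, mfderiv (𝓡 4) 𝓘(ℝ, ℝ) f (j n) (pfaffAdjCol (s (j n)) k) ≠ 0 := by
  have hx₀ : j n ∈ fold s := h.range_eq ▸ mem_range_self n
  have hs0 : s (j n) ≠ 0 := h.apply_ne_zero hx₀
  have hPf : pfaffian (s (j n)) = 0 := (mem_fold_iff_pfaffian_eq_zero s (j n)).1 hx₀
  by_contra hall
  push Not at hall
  -- two independent columns span the radical
  obtain ⟨k, l, hind⟩ := exists_linearIndependent_pfaffAdjCol (s (j n)) hs0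
  set S : Submodule ℝ (EuclideanSpace ℝ (Fin 4)) :=
    Submodule.span ℝ (Set.range ![pfaffAdjCol (s (j n)) k, pfaffAdjCol (s (j n)) l]) with hS
  have hS2 : Module.finrank ℝ S = 2 := by
    rw [hS, finrank_span_eq_card hind]
    simp
  have hSle : S ≤ altKer (s (j n)) := by
    refine Submodule.span_le.2 ?_
    rintro _ ⟨m, rfl⟩
    fin_cases m
    · exact pfaffAdjCol_mem_altKer _ hPf k
    · exact pfaffAdjCol_mem_altKer _ hPf l
  have hSeq : S = altKer (s (j n)) :=
    Submodule.eq_of_le_of_finrank_eq hSle (by rw [hS2, finrank_altKer_eq_two _ hPf hs0])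
  -- all columns lie in `ker df`, hence so does the radical
  let L : EuclideanSpace ℝ (Fin 4) →ₗ[ℝ] ℝ := (mfderiv (𝓡 4) 𝓘(ℝ, ℝ) f (j n)).toLinearMap
  have hSker : S ≤ LinearMap.ker L := by
    refine Submodule.span_le.2 ?_
    rintro _ ⟨m, rfl⟩
    fin_cases m
    · exact hall k
    · exact hall l
  -- but the radical contains a vector transverse to the fold
  obtain ⟨v, hv, hvr⟩ := h.maximalRank n
  have hvS : (v : EuclideanSpace ℝ (Fin 4)) ∈ S := by rw [hSeq]; exact hv
  have hvK : mfderiv (𝓡 4) 𝓘(ℝ, ℝ) f (j n) v = 0 := hSker hvS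
  exact hvr (hker v hvK)

/-- **A local kernel-adapted section near a fold point.** If `df` has kernel `TZ` along the
fold then near every fold point `x₀` there is a smooth local vector field `V` with `V(f) = 1`
and with `V_x ∈ ker ω_x` at every fold point `x` of the neighbourhood: a transported adjugate
column transverse to the fold, divided by `V(f)`. [cite: CannasdasilvaGuilleminPires2010, Def. 2.1] -/
theorem IsFoldedForm.exists_local_kernelSection {s : MForm (𝓡 4) M ℝ 2} (h : IsFoldedForm s N j)
    {f : M → ℝ} (hf : ContMDiff (𝓡 4) 𝓘(ℝ, ℝ) ∞ f)
    (hker : ∀ (n : N) (v : TangentSpace (𝓡 4) (j n)), mfderiv (𝓡 4) 𝓘(ℝ, ℝ) f (j n) v = 0 →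
      v ∈ Set.range (mfderiv (𝓡 3) (𝓡 4) j n))
    {x₀ : M} (hx₀ : x₀ ∈ fold s) :
    ∃ u ∈ 𝓝 x₀, ∃ V : Π x : M, TangentSpace (𝓡 4) x,
      ContMDiffOn (𝓡 4) (𝓡 4).tangent ∞ (fun x => (⟨x, V x⟩ : TangentBundle (𝓡 4) M)) u ∧
      ∀ x ∈ u, (x ∈ fold s → ∀ w : TangentSpace (𝓡 4) x, s x ![V x, w] = 0) ∧
        mlineDeriv (𝓡 4) f x (V x) = 1 := by
  -- `x₀ = j n`
  obtain ⟨n, rfl⟩ : x₀ ∈ Set.range j := h.range_eq ▸ hx₀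
  obtain ⟨k, hk⟩ := h.exists_mfderiv_pfaffAdjCol_ne_zero n (hker n)
  set W : Π x : M, TangentSpace (𝓡 4) x := fun x =>
    (trivializationAt (EuclideanSpace ℝ (Fin 4)) (TangentSpace (𝓡 4) : M → Type _) (j n)).symmL ℝ x
      (pfaffAdjCol (s.inChart (j n) (extChartAt (𝓡 4) (j n) x)) k) with hW
  have hWs : ContMDiffOn (𝓡 4) (𝓡 4).tangent ∞ (fun x => (⟨x, W x⟩ : TangentBundle (𝓡 4) M))
      (extChartAt (𝓡 4) (j n)).source := contMDiffOn_symmL_pfaffAdjCol h.smooth (j n) k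
  -- the value at the centre is the adjugate column of `ω_{j n}` itself
  have hW0 : (W (j n) : EuclideanSpace ℝ (Fin 4)) = pfaffAdjCol (s (j n)) k :=
    (symmL_trivializationAt_self (j n) _).trans
      (congrArg (fun α => pfaffAdjCol α k) (MForm.inChart_apply_self s (j n)))
  -- `W(f)` is smooth on the chart domain and non-zero at the centre
  set g : M → ℝ := fun x => mlineDeriv (𝓡 4) f x (W x) with hg
  have hgs : ContMDiffOn (𝓡 4) 𝓘(ℝ, ℝ) ∞ g (extChartAt (𝓡 4) (j n)).source :=
    contMDiffOn_mlineDeriv_section hf hWs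
  have hg0 : g (j n) ≠ 0 := by
    intro h0
    change mfderiv (𝓡 4) 𝓘(ℝ, ℝ) f (j n) (W (j n)) = 0 at h0
    have e1 := congrArg (mfderiv (𝓡 4) 𝓘(ℝ, ℝ) f (j n)) hW0
    exact hk (e1.symm.trans h0)
  have hsrc : (extChartAt (𝓡 4) (j n)).source ∈ 𝓝 (j n) := extChartAt_source_mem_nhds (j n)
  have hcont : ContinuousAt g (j n) :=
    (hgs.continuousOn.continuousWithinAt (mem_extChartAt_source (j n))).continuousAt hsrc
  set u : Set M := (extChartAt (𝓡 4) (j n)).source ∩ {x | g x ≠ 0} with hu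
  have hun : u ∈ 𝓝 (j n) := Filter.inter_mem hsrc (hcont.eventually_ne hg0)
  have hginv : ContMDiffOn (𝓡 4) 𝓘(ℝ, ℝ) ∞ (fun x => (g x)⁻¹) u :=
    (hgs.mono inter_subset_left).inv₀ fun x hx => hx.2
  refine ⟨u, hun, fun x => (g x)⁻¹ • W x, hginv.smul_section (hWs.mono inter_subset_left),
    fun x hx => ⟨fun hxf w => ?_, ?_⟩⟩
  · change s x ![(g x)⁻¹ • W x, w] = 0
    rw [mform_smul_left]
    have := symmL_pfaffAdjCol_mem_ker s (j n) k hx.1 hxf w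
    change s x ![W x, w] = 0 at this
    rw [this, mul_zero]
  · change mlineDeriv (𝓡 4) f x ((g x)⁻¹ • W x) = 1
    rw [mlineDeriv_smul]
    exact inv_mul_cancel₀ hx.2

end Local

/-! ### The global kernel-adapted field -/

section Global

omit [IsManifold (𝓡 4) ∞ M] in
/-- The constraint sets: over a fold point, the vectors of the kernel of `ω` with `v(f) = 1`;
elsewhere, everything. They are convex. [folklore] -/
theorem convex_kernelConstraint (s : MForm (𝓡 4) M ℝ 2) (f : M → ℝ) (x : M) :
    Convex ℝ {v : TangentSpace (𝓡 4) x |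
      x ∈ fold s → (∀ w : TangentSpace (𝓡 4) x, s x ![v, w] = 0) ∧ mlineDeriv (𝓡 4) f x v = 1} := by
  intro v hv w hw a b _ _ hab hx
  obtain ⟨hv1, hv2⟩ := hv hx
  obtain ⟨hw1, hw2⟩ := hw hx
  refine ⟨fun w' => ?_, ?_⟩
  · rw [mform_add_left, mform_smul_left, mform_smul_left, hv1 w', hw1 w', mul_zero,
      mul_zero, add_zero]
  · rw [mlineDeriv_add, mlineDeriv_smul, mlineDeriv_smul, hv2, hw2, mul_one, mul_one, hab]

variable [T2Space M] [SigmaCompactSpace M]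

/-- **A global kernel-adapted vector field.** For a folded form and a smooth function `f` whose
differential has kernel `TZ` at every fold point (e.g. the defining function of
`OrigamiFoldDefiningFunction.lean`), there is a smooth vector field `V` on `M` with
`V_x ∈ ker ω_x` and `V(f)(x) = 1` at every fold point `x` — a smooth transversal section of the
kernel bundle `E` of Def. 2.1 along the fold, normalised against `f` (Mathlib's
`exists_contMDiffSection_forall_mem_convex_of_local`, fed with the local kernel sections and the
zero field off the fold). [cite: CannasdasilvaGuilleminPires2010, Def. 2.1] -/
theorem IsFoldedForm.exists_kernelAdaptedField {s : MForm (𝓡 4) M ℝ 2} (h : IsFoldedForm s N j)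
    {f : M → ℝ} (hf : ContMDiff (𝓡 4) 𝓘(ℝ, ℝ) ∞ f)
    (hker : ∀ (n : N) (v : TangentSpace (𝓡 4) (j n)), mfderiv (𝓡 4) 𝓘(ℝ, ℝ) f (j n) v = 0 →
      v ∈ Set.range (mfderiv (𝓡 3) (𝓡 4) j n)) :
    ∃ V : Cₛ^∞⟮𝓡 4; EuclideanSpace ℝ (Fin 4), (TangentSpace (𝓡 4) : M → Type _)⟯,
      ∀ x ∈ fold s, (∀ w : TangentSpace (𝓡 4) x, s x ![V x, w] = 0) ∧
        mlineDeriv (𝓡 4) f x (V x) = 1 := by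
  obtain ⟨V, hV⟩ : ∃ V : Cₛ^∞⟮𝓡 4; EuclideanSpace ℝ (Fin 4), (TangentSpace (𝓡 4) : M → Type _)⟯,
      ∀ x, V x ∈ {v : TangentSpace (𝓡 4) x | x ∈ fold s →
        (∀ w : TangentSpace (𝓡 4) x, s x ![v, w] = 0) ∧ mlineDeriv (𝓡 4) f x v = 1} := by
    refine exists_contMDiffSection_forall_mem_convex_of_local (𝓡 4)
      (TangentSpace (𝓡 4) : M → Type _) _ (fun x => convex_kernelConstraint s f x) (fun x₀ => ?_)
    by_cases hx₀ : x₀ ∈ fold s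
    · obtain ⟨u, hu, V, hV, hV1⟩ := h.exists_local_kernelSection hf hker hx₀
      exact ⟨u, hu, V, hV, fun y hy hyf => ⟨(hV1 y hy).1 hyf, (hV1 y hy).2⟩⟩
    · refine ⟨(fold s)ᶜ, h.isClosed_fold.isOpen_compl.mem_nhds hx₀, fun _ => 0, ?_,
        fun y hy hyf => absurd hyf hy⟩
      exact (contMDiff_zeroSection ℝ (TangentSpace (𝓡 4) : M → Type _)).contMDiffOn
  exact ⟨V, fun x hx => hV x hx⟩

end Global

/-! ### A kernel-adapted field of unit speed across a band: the kernel-adapted collar -/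

section UnitField

/-- The cut-off reciprocal `u ↦ χ(4u - 1) / u` (`χ` = Mathlib's `Real.smoothTransition`): a
`C^∞` function on `ℝ` equal to `1/u` for `u ≥ 1/2` and to `0` for `u ≤ 1/4`. [folklore] -/
theorem contDiff_smoothTransition_mul_inv :
    ContDiff ℝ ∞ fun u : ℝ => Real.smoothTransition (4 * u - 1) * u⁻¹ := by
  rw [contDiff_iff_contDiffAt]
  intro u
  by_cases hu : 0 < u
  · exact ((Real.smoothTransition.contDiffAt (n := ⊤)).comp u
      ((contDiffAt_const.mul contDiffAt_id).sub contDiffAt_const)).mul (contDiffAt_inv ℝ hu.ne')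
  · -- near `u ≤ 0` the function vanishes identically
    have hev : (fun u : ℝ => Real.smoothTransition (4 * u - 1) * u⁻¹) =ᶠ[𝓝 u] fun _ => 0 := by
      have : Iio (1 / 4 : ℝ) ∈ 𝓝 u := Iio_mem_nhds (by push Not at hu; linarith)
      filter_upwards [this] with t ht
      rw [Real.smoothTransition.zero_of_nonpos (by rw [mem_Iio] at ht; linarith), zero_mul]
    exact (contDiffAt_const (c := (0 : ℝ))).congr_of_eventuallyEq hev

/-- On `u ≥ 1/2` the cut-off reciprocal is `1/u`. [folklore] -/
theorem smoothTransition_mul_inv_of_half_le {u : ℝ} (hu : 1 / 2 ≤ u) :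
    Real.smoothTransition (4 * u - 1) * u⁻¹ = u⁻¹ := by
  rw [Real.smoothTransition.one_of_one_le (by linarith), one_mul]

/-- On a compact space, a band `f⁻¹[-δ, δ]` around the zero level of a continuous function lies
inside any open set containing the zero level. [folklore] -/
theorem exists_band_subset {X : Type*} [TopologicalSpace X] [CompactSpace X] {f : X → ℝ}
    (hf : Continuous f) {O : Set X} (hO : IsOpen O) (h0 : f ⁻¹' {0} ⊆ O) :
    ∃ δ : ℝ, 0 < δ ∧ f ⁻¹' Icc (-δ) δ ⊆ O := by
  rcases (Oᶜ).eq_empty_or_nonempty with he | hne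
  · refine ⟨1, one_pos, fun x _ => ?_⟩
    by_contra hx
    have : x ∈ Oᶜ := hx
    rw [he] at this
    exact this
  · have hK : IsCompact Oᶜ := hO.isClosed_compl.isCompact
    obtain ⟨x₀, hx₀, hmin⟩ := hK.exists_isMinOn hne (continuous_abs.comp hf).continuousOn
    have hpos : 0 < |f x₀| := by
      rw [abs_pos]
      exact fun h => hx₀ (h0 h)
    refine ⟨|f x₀| / 2, by positivity, fun x hx => ?_⟩
    by_contra hxO
    have h1 : |f x₀| ≤ |f x| := hmin (a := x) hxO
    have h2 : |f x| ≤ |f x₀| / 2 := abs_le.2 ⟨by linarith [hx.1], hx.2⟩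
    linarith

variable [T2Space M] [CompactSpace M]

/-- **A kernel-adapted unit field across a band of the fold** (the input of Milnor's product
collar, `Literature.Topology.FourManifolds.LevelUnitField`). On a compact oriented 4-manifold,
for a folded form `ω` and a smooth function `f` vanishing exactly on the fold with `ker df = TZ`
there, there is a smooth vector field `ξ` on `M` with `ξ(f) = 1` on a band `f⁻¹[-δ, δ]`,
`δ > 0`, and `ξ_x ∈ ker ω_x` at every fold point: the kernel-adapted field `V` (`V(f) = 1` on
the fold, hence `> 1/2` on a band by compactness) multiplied by the cut-off reciprocal of
`V(f)`. The flow lines of `ξ` out of the fold give a product collar `Z × (-δ, δ) ≅ f⁻¹(-δ, δ)`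
(`LevelUnitField.fl`, `RegularLevelCollar.lean`) whose `∂/∂t` along the fold lies in `ker ω` —
the collar on which step (S1) of the unfolding normalises `ω` (Cannas da Silva–Guillemin–
Woodward 2000, Thm. 1). [cite: CannasdasilvaGuilleminPires2010, Def. 2.1 and Prop. 2.8] -/
theorem IsFoldedForm.exists_kernelAdapted_levelUnitField {s : MForm (𝓡 4) M ℝ 2}
    (h : IsFoldedForm s N j) {f : M → ℝ} (hf : ContMDiff (𝓡 4) 𝓘(ℝ, ℝ) ∞ f)
    (hf0 : ∀ x, f x = 0 → x ∈ fold s)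
    (hker : ∀ (n : N) (v : TangentSpace (𝓡 4) (j n)), mfderiv (𝓡 4) 𝓘(ℝ, ℝ) f (j n) v = 0 →
      v ∈ Set.range (mfderiv (𝓡 3) (𝓡 4) j n)) :
    ∃ U : LevelUnitField 3 f 0, ∀ x ∈ fold s, ∀ w : TangentSpace (𝓡 4) x, s x ![U.ξ x, w] = 0 := by
  obtain ⟨V, hV⟩ := h.exists_kernelAdaptedField hf hker
  set g : M → ℝ := fun x => mlineDeriv (𝓡 4) f x (V x) with hg
  have hgs : ContMDiff (𝓡 4) 𝓘(ℝ, ℝ) ∞ g := contMDiff_mlineDeriv_section hf V.contMDiff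
  -- the band where `V(f) > 1/2`
  set O : Set M := {x | 1 / 2 < g x} with hO
  have hOo : IsOpen O := isOpen_lt continuous_const hgs.continuous
  have hZO : f ⁻¹' {0} ⊆ O := fun x hx => by
    have hxf : x ∈ fold s := hf0 x hx
    change 1 / 2 < g x
    rw [hg]
    change 1 / 2 < mlineDeriv (𝓡 4) f x (V x)
    rw [(hV x hxf).2]
    norm_num
  obtain ⟨δ, hδ, hband⟩ := exists_band_subset hf.continuous hOo hZO
  -- the field `ξ = (χ(4g-1)/g) • V`
  set r : M → ℝ := fun x => Real.smoothTransition (4 * g x - 1) * (g x)⁻¹ with hr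
  have hrs : ContMDiff (𝓡 4) 𝓘(ℝ, ℝ) ∞ r :=
    contDiff_smoothTransition_mul_inv.comp_contMDiff hgs
  refine ⟨⟨fun x => r x • V x, hrs.smul_section V.contMDiff, hf, δ, hδ, fun x hx => ?_⟩,
    fun x hx w => ?_⟩
  · -- unit speed on the band
    have hxO : x ∈ O := hband (by simpa using hx)
    have hgx : 1 / 2 < g x := hxO
    change mlineDeriv (𝓡 4) f x (r x • V x) = 1
    rw [mlineDeriv_smul, hr]
    change Real.smoothTransition (4 * g x - 1) * (g x)⁻¹ * g x = 1
    rw [smoothTransition_mul_inv_of_half_le hgx.le, inv_mul_cancel₀ (by linarith)]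
  · -- in the kernel along the fold
    change s x ![r x • V x, w] = 0
    rw [mform_smul_left, (hV x hx).1 w, mul_zero]

end UnitField

end Literature.Geometry.Symplectic

end
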